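import Literature.MathematicalPhysics.QuantumFieldTheory.Balaban1983to89.Beta.PuncturedRiemannSum

/-!
# `Balaban1983to89.Beta.PuncturedRiemannSumFamily` — the thin DELTA over `Beta.PuncturedRiemannSum` ruled by the β lead
(journal 2026-08-19T02:34:05Z/02:34:52Z): (f) the CLASS BRIDGE `C/‖p‖_∞² ↔ C₀ + C₁/ε(p)` on the Brillouin zone (both
directions — «the same class», now a theorem), (d) FINITE-FAMILY uniformity of the volume threshold, (e) a kernel-checked
CONSISTENCY re-derivation of lit1's `torusGreen_tendsto_latticeGreen` (ADS15 (3.15)) from an5's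
`momentumAverage_singular_approx` — a second-engine check of both files

HONEST FRAMING (cell rule, verbatim): discharging `BetaPertH` makes Bałaban's UV stability UNCONDITIONAL — a real
constructive-QFT result; it is NOT the continuum limit and NOT the Clay problem.  (Gloss, BETA-SPEC v1.8d/v1.9b
l. 17–18, GAPS G-ref2-14 (a) / G-ref2-20 (a), verbatim: «UNCONDITIONAL» in [Balaban1989LargeFieldII] (B16) p. 355's
interval-hypothesis sense ONLY (`FlowStepRuns.p355Unconditional_of_partialSums` keeps `hnodes`); the located leaves
G-adv3-2 (left inequality of (0.1)/(2.50), d = 4), G-adv3-1 (U2 transfer of B14 Cor. 3's lower bound) and `SecondExpLeaf`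
REMAIN.  Gloss 2, BETA-SPEC v1.9e, beta-ref C-beta-78, BINDING: «unconditional» = `Beta.Assembly.EventualForm`-unconditional END
statement, NOT «Theorem 2 as printed»; Gloss 3″, BETA-SPEC v1.9r §7.20 (c), BINDING: on the primary road «unconditional» =
the interval hypothesis of [B12] Thm 2 p. 259 REPLACED by the (R10-1′) partial-sums carrier, END statements under the
explicit γ-smallness restrictions of the kernel binders; never Thm 2 as printed, never continuum / mass gap / Clay.)  THIS
MODULE DISCHARGES NOTHING of the series and instantiates NO binder of the wall.  It is pure lattice analysis — folklore
real analysis on the momentum grid of the torus — and asserts nothing about Bałaban's operators (unit `b2b-balaban-beta-lit1`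
gen 9 = the β sub-cell's literature/transfer seat LIT1; journal node PUNCTURED-RS-FAMILY; the lead's dedup ruling «no two
seats on one lemma» reduced this seat's generic draft to the present delta, the generic theorems being an5-g8's
`Beta.PuncturedRiemannSum` v1/v1.1, IMPORTED AND USED BY NAME, never re-proved).

## Why (consumers; internal division of labour, NOT citations)

Under the lead's reading (R13-1) («T ↗ ℤ⁴ first», [Balaban1987RG1] p. 264) the β objects are infinite-volume limits,
along even cubic periods, of torus objects; for momentum-space entries the limit lemma is, by symbol class,
`BrillouinRiemannSumUniform.momentumAverage_uniform_approx` (continuous on the closed zone),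
`PuncturedRiemannSum.momentumAverage_punctured_approx` (bounded, continuous off `0`), `….momentumAverage_singular_approx`
(`‖G‖ ≤ C₀ + C₁/ε(p)` off `0`, `d ≥ 3`), `B4TorusKernel.torusKernel_descend_eq` (strip-analytic, images road).  The
bookkeeping rows ((ii-a)/(ii-a′): an4 / an2 / an5 successor) meet (1) symbols bounded in the SUP-NORM form
`‖F p‖ ≤ C‖p‖_∞⁻²` (as in `LatticeGreenRiemannSum.abs_greenIntegrand_le`, `LatticeGreenGradient`, `PoissonInterior`) —
§1–§2 let them call an5's theorems; (2) FINITELY MANY symbols at once (intra-block positions `(Fin N)^d`, window points,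
directions `μν`) — §3 gives one threshold.  §4 is the second-engine check the lead asked for.

## What is proved (all `[folklore]`; no `def … : Prop`, no axiom, no sorry)

* §1 `dispersion_le_mul_norm_sq` — `ε(p) = Σ_i (1 − cos p_i) ≤ (d/2)·‖p‖_∞²` (everywhere; `1 − cos t ≤ t²/2`), the converse
  direction of lit1's `mul_norm_sq_le_dispersion` (`(2/π²)‖p‖_∞² ≤ ε(p)` on the zone); `inv_norm_sq_le_inv_dispersion`
  (`‖p‖⁻² ≤ (d/2)/ε(p)`, p ≠ 0 in the zone) and `inv_dispersion_le_inv_norm_sq` (`1/ε(p) ≤ (π²/2)‖p‖⁻²`);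
  `nonneg_of_norm_le_inv_norm_sq` (a bound `‖F p‖ ≤ C‖p‖⁻²` at one punctured-zone point forces `0 ≤ C`, `d ≥ 1`).
* §2 THE BRIDGE: `singularBound_of_norm_le_inv_norm_sq` (`‖F‖ ≤ C/‖p‖² ⟹ ‖F‖ ≤ 0 + (Cd/2)/ε(p)`) and
  `norm_le_inv_norm_sq_of_singularBound` (`‖F‖ ≤ C₀ + C₁/ε ⟹ ‖F‖ ≤ (C₀π² + C₁π²/2)/‖p‖²`, `C₀ ≥ 0`) — the two majorant classes
  COINCIDE on the punctured zone; hence `momentumAverage_approx_of_norm_le_inv_norm_sq` and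
  `cornerRiemannSum_approx_of_norm_le_inv_norm_sq`: an5's singular-class theorems in the sup-norm-majorant form (`d ≥ 3`).
* §3 FINITE FAMILIES: `momentumAverage_singular_approx_finset`, `momentumAverage_punctured_approx_finset`,
  `momentumAverage_approx_of_norm_le_inv_norm_sq_finset` — one `L₀` for all symbols `F i`, `i ∈ s : Finset ι`.
* §4 CONSISTENCY (`example`s, kernel-checked at every build; an `example` rather than a `theorem` because the statement IS the
  landed `LatticeGreenRiemannSum.torusGreen_tendsto_latticeGreen` and the gate rejects restated landed statements):
  ADS15 (3.15) — `|torusGreen (z mod L) − latticeGreen z| ≤ ε` for even `L ≥ L₀`, `d ≥ 3` — re-derived from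
  `momentumAverage_singular_approx` with `G = greenIntegrand z`, `C₀ = 0`, `C₁ = 1` (`|cos| ≤ 1`), continuity off `0`,
  `2π`-periodicity (`greenIntegrand_add_int_mul`), and the two normalisation identities `torusGreen_proj_eq` / `latticeGreen_eq`.
  Both engines (lit1's hard-wired proof of 2026-08-15 and an5's generic singular theorem of 2026-08-19) therefore agree on
  the one statement they share.

References for the underlying analysis (context only; nothing is cited as a hypothesis): Aizenman–Duminil-Copin–
Sidoravicius, CMP 334 (2015) §3.3, arXiv v3 (3.15) [AizenmanDuminilCopinSidoraviciusCMP2015]; Friedli–Velenik 2017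
§10.5.2 (10.41) (the Riemann-sum passage; lit3-g10 C-lit3g10-2 A2 notes that the siblings' «§10.4» locator is the Chessboard
estimate) [FriedliVelenik2017].  Value = thin dictionary/bookkeeping delta + a second-engine check, NOT summit progress.
-/

noncomputable section

namespace Literature.MathematicalPhysics.QuantumFieldTheory.Balaban1983to89.Beta.PuncturedRiemannSumFamily

open MeasureTheory Filter Topology Finset Real
open Literature.Probability.LatticeModels
open Literature.MathematicalPhysics.QuantumFieldTheory.Balaban1983to89.Beta.PuncturedRiemannSum

variable {d : ℕ} {E : Type*} [NormedAddCommGroup E] [NormedSpace ℝ E] [CompleteSpace E]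

/-! ## §1 The dispersion against the sup-norm, both ways -/

/-- `ε(p) = Σ_i (1 − cos p_i) ≤ (d/2)·‖p‖_∞²` for every `p` (`1 − cos t ≤ t²/2`, `|p_i| ≤ ‖p‖_∞`) — the converse direction
of `mul_norm_sq_le_dispersion`. [folklore] -/
theorem dispersion_le_mul_norm_sq (p : Fin d → ℝ) : dispersion p ≤ d / 2 * ‖p‖ ^ 2 := by
  unfold dispersion
  have hcoord : ∀ i, 1 - Real.cos (p i) ≤ ‖p‖ ^ 2 / 2 := fun i => by
    have h1 : 1 - Real.cos (p i) ≤ (p i) ^ 2 / 2 := by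
      linarith [Real.one_sub_sq_div_two_le_cos (x := p i)]
    have h2 : (p i) ^ 2 ≤ ‖p‖ ^ 2 := by
      rw [← sq_abs, ← Real.norm_eq_abs]
      exact pow_le_pow_left₀ (norm_nonneg _) (norm_le_pi_norm p i) 2
    linarith
  calc ∑ i, (1 - Real.cos (p i)) ≤ ∑ _i : Fin d, ‖p‖ ^ 2 / 2 := Finset.sum_le_sum fun i _ => hcoord i
    _ = d / 2 * ‖p‖ ^ 2 := by
        rw [Finset.sum_const, Finset.card_univ, Fintype.card_fin, nsmul_eq_mul]; ring

/-- On the punctured zone `‖p‖⁻² ≤ (d/2)·ε(p)⁻¹`. [folklore] -/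
theorem inv_norm_sq_le_inv_dispersion {p : Fin d → ℝ} (hp : p ∈ brillouin d) (hp0 : p ≠ 0) :
    (‖p‖ ^ 2)⁻¹ ≤ d / 2 * (1 / dispersion p) := by
  have hεpos := dispersion_pos_of_mem_brillouin hp hp0
  have hpos : 0 < ‖p‖ := norm_pos_iff.2 hp0
  rw [inv_eq_one_div, ← div_eq_mul_one_div, div_le_div_iff₀ (by positivity) hεpos, one_mul]
  exact dispersion_le_mul_norm_sq p

/-- On the punctured zone `ε(p)⁻¹ ≤ (π²/2)·‖p‖⁻²` (from `mul_norm_sq_le_dispersion`). [folklore] -/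
theorem inv_dispersion_le_inv_norm_sq {p : Fin d → ℝ} (hp : p ∈ brillouin d) (hp0 : p ≠ 0) :
    1 / dispersion p ≤ π ^ 2 / 2 * (‖p‖ ^ 2)⁻¹ := by
  have hε := mul_norm_sq_le_dispersion hp
  have hpos : 0 < ‖p‖ := norm_pos_iff.2 hp0
  calc 1 / dispersion p ≤ 1 / (2 / π ^ 2 * ‖p‖ ^ 2) := one_div_le_one_div_of_le (by positivity) hε
    _ = π ^ 2 / 2 * (‖p‖ ^ 2)⁻¹ := by
        have hπ : (π : ℝ) ≠ 0 := Real.pi_ne_zero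
        field_simp

omit [NormedSpace ℝ E] [CompleteSpace E] in
/-- A bound `‖F p‖ ≤ C‖p‖⁻²` at one point of the punctured zone forces `0 ≤ C`; the zone of `ℝ^d`, `d ≥ 1`, has such a
point (`p = (1,…,1)`). [folklore] -/
theorem nonneg_of_norm_le_inv_norm_sq (hd : 1 ≤ d) {F : (Fin d → ℝ) → E} {C : ℝ}
    (hbd : ∀ p ∈ brillouin d, p ≠ 0 → ‖F p‖ ≤ C * (‖p‖ ^ 2)⁻¹) : 0 ≤ C := by
  set p₁ : Fin d → ℝ := fun _ => 1 with hp₁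
  have hmem : p₁ ∈ brillouin d := fun i _ => by
    simp only [hp₁, Set.mem_Icc]
    constructor <;> linarith [Real.two_le_pi]
  have hne : p₁ ≠ 0 := by
    intro h
    have := congr_fun h ⟨0, by omega⟩
    simp [hp₁] at this
  have h := hbd p₁ hmem hne
  have hpos : 0 < (‖p₁‖ ^ 2)⁻¹ := by
    have := norm_pos_iff.2 hne; positivity
  nlinarith [norm_nonneg (F p₁)]

/-! ## §2 The class bridge and an5's singular theorems in the sup-norm-majorant form -/

omit [NormedSpace ℝ E] [CompleteSpace E] in
/-- **Bridge, sup-norm ⟹ `1/ε`:** `‖F p‖ ≤ C‖p‖⁻²` on the punctured zone (`C ≥ 0`) gives an5's majorant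
`‖F p‖ ≤ 0 + (C·d/2)/ε(p)` there. [folklore] -/
theorem singularBound_of_norm_le_inv_norm_sq {F : (Fin d → ℝ) → E} {C : ℝ} (hC : 0 ≤ C)
    (hbd : ∀ p ∈ brillouin d, p ≠ 0 → ‖F p‖ ≤ C * (‖p‖ ^ 2)⁻¹) :
    ∀ p ∈ brillouin d, p ≠ 0 → ‖F p‖ ≤ 0 + C * (d / 2) / dispersion p := by
  intro p hp hp0
  calc ‖F p‖ ≤ C * (‖p‖ ^ 2)⁻¹ := hbd p hp hp0
    _ ≤ C * (d / 2 * (1 / dispersion p)) := by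
        gcongr; exact inv_norm_sq_le_inv_dispersion hp hp0
    _ = 0 + C * (d / 2) / dispersion p := by ring

omit [NormedSpace ℝ E] [CompleteSpace E] in
/-- **Bridge, `1/ε` ⟹ sup-norm:** `‖F p‖ ≤ C₀ + C₁/ε(p)` on the punctured zone (`C₀, C₁ ≥ 0`) gives
`‖F p‖ ≤ (C₀π² + C₁π²/2)‖p‖⁻²` there (`‖p‖_∞ ≤ π` on the zone).  With the previous theorem: the two majorant classes
coincide on the punctured zone. [folklore] -/
theorem norm_le_inv_norm_sq_of_singularBound {F : (Fin d → ℝ) → E} {C₀ C₁ : ℝ} (hC₀ : 0 ≤ C₀) (hC₁ : 0 ≤ C₁)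
    (hB : ∀ p ∈ brillouin d, p ≠ 0 → ‖F p‖ ≤ C₀ + C₁ / dispersion p) :
    ∀ p ∈ brillouin d, p ≠ 0 → ‖F p‖ ≤ (C₀ * π ^ 2 + C₁ * (π ^ 2 / 2)) * (‖p‖ ^ 2)⁻¹ := by
  intro p hp hp0
  have hpos : 0 < ‖p‖ := norm_pos_iff.2 hp0
  have hle : ‖p‖ ≤ π := (pi_norm_le_iff_of_nonneg Real.pi_pos.le).2 fun i => by
    rw [Real.norm_eq_abs]; exact abs_le.2 (hp i (Set.mem_univ i))
  -- `1 ≤ π²‖p‖⁻²` on the zone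
  have h1 : (1 : ℝ) ≤ π ^ 2 * (‖p‖ ^ 2)⁻¹ := by
    rw [← div_eq_mul_inv, le_div_iff₀ (by positivity), one_mul]
    exact pow_le_pow_left₀ hpos.le hle 2
  calc ‖F p‖ ≤ C₀ + C₁ / dispersion p := hB p hp hp0
    _ = C₀ * 1 + C₁ * (1 / dispersion p) := by ring
    _ ≤ C₀ * (π ^ 2 * (‖p‖ ^ 2)⁻¹) + C₁ * (π ^ 2 / 2 * (‖p‖ ^ 2)⁻¹) := by
        gcongr
        exact inv_dispersion_le_inv_norm_sq hp hp0
    _ = (C₀ * π ^ 2 + C₁ * (π ^ 2 / 2)) * (‖p‖ ^ 2)⁻¹ := by ring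

variable (d) in
/-- **Punctured momentum averages, sup-norm-majorant form** (`d ≥ 3`, even `L`): for `F` continuous on `[-π,π]^d ∖ {0}`,
`‖F p‖ ≤ C‖p‖_∞⁻²` there, and `2π`-periodic, `‖L^{-d} Σ_{k ≠ 0} F(2πk/L) − (2π)^{-d} ∫_{[-π,π]^d} F‖ ≤ ε` for all even
`L ≥ L₀` — an5's `momentumAverage_singular_approx` through the bridge (`0 ≤ C` is automatic). [folklore] -/
theorem momentumAverage_approx_of_norm_le_inv_norm_sq (hd : 3 ≤ d) {F : (Fin d → ℝ) → E} {C : ℝ}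
    (hcont : ContinuousOn F (brillouin d \ {0}))
    (hbd : ∀ p ∈ brillouin d, p ≠ 0 → ‖F p‖ ≤ C * (‖p‖ ^ 2)⁻¹)
    (hper : ∀ (p : Fin d → ℝ) (n : Fin d → ℤ), F (fun i => p i + 2 * π * (n i : ℝ)) = F p)
    {ε : ℝ} (hε : 0 < ε) :
    ∃ L₀ : ℕ, ∀ (L : ℕ) [NeZero L], Even L → L₀ ≤ L →
      ‖((L ^ d : ℕ) : ℝ)⁻¹ • ∑ k ∈ (univ : Finset (TorusSite d L)).erase 0, F (latticeMomentum L k) -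
          ((2 * π) ^ d)⁻¹ • ∫ p in brillouin d, F p‖ ≤ ε := by
  have hC : 0 ≤ C := nonneg_of_norm_le_inv_norm_sq (by omega) hbd
  exact momentumAverage_singular_approx hd le_rfl (by positivity : (0 : ℝ) ≤ C * (d / 2)) hcont
    (singularBound_of_norm_le_inv_norm_sq hC hbd) hper hε

variable (d) in
/-- **Punctured corner sums, sup-norm-majorant form** (`d ≥ 3`, even `L`): the corner-sum version
(`δ^d Σ_{j ≠ j₀} F(c_j)` against `∫_{[-π,π]^d} F`), from an5's `cornerRiemannSum_singular_approx` through the bridge.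
[folklore] -/
theorem cornerRiemannSum_approx_of_norm_le_inv_norm_sq (hd : 3 ≤ d) {F : (Fin d → ℝ) → E} {C : ℝ}
    (hcont : ContinuousOn F (brillouin d \ {0}))
    (hbd : ∀ p ∈ brillouin d, p ≠ 0 → ‖F p‖ ≤ C * (‖p‖ ^ 2)⁻¹) {ε : ℝ} (hε : 0 < ε) :
    ∃ L₀ : ℕ, ∀ (L : ℕ) [NeZero L], Even L → L₀ ≤ L →
      ‖(∑ j ∈ (univ : Finset (TorusSite d L)).erase (centerIndex d L), (gridStep L) ^ d • F (cellCorner j)) -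
          ∫ p in brillouin d, F p‖ ≤ ε := by
  have hC : 0 ≤ C := nonneg_of_norm_le_inv_norm_sq (by omega) hbd
  exact cornerRiemannSum_singular_approx hd le_rfl (by positivity : (0 : ℝ) ≤ C * (d / 2)) hcont
    (singularBound_of_norm_le_inv_norm_sq hC hbd) hε

/-! ## §3 Finite families: one volume threshold for finitely many symbols -/

variable (d) in
/-- **Finite families, singular class.**  For symbols `G i`, `i ∈ s : Finset ι`, each continuous off `0`, `2π`-periodic
and with `‖G i p‖ ≤ C₀ i + C₁ i/ε(p)` (`p ≠ 0`; `C₀ i, C₁ i ≥ 0`), `d ≥ 3`: ONE `L₀` such that every `G i` has its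
punctured momentum average within `ε` of its zone average for all even `L ≥ L₀` (`Finset.sup` of the individual
thresholds of `momentumAverage_singular_approx`). [folklore] -/
theorem momentumAverage_singular_approx_finset (hd : 3 ≤ d) {ι : Type*} (s : Finset ι)
    {G : ι → (Fin d → ℝ) → E} {C₀ C₁ : ι → ℝ} (hC₀ : ∀ i ∈ s, 0 ≤ C₀ i) (hC₁ : ∀ i ∈ s, 0 ≤ C₁ i)
    (hG : ∀ i ∈ s, ContinuousOn (G i) (brillouin d \ {0}))
    (hB : ∀ i ∈ s, ∀ p ∈ brillouin d, p ≠ 0 → ‖G i p‖ ≤ C₀ i + C₁ i / dispersion p)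
    (hper : ∀ i ∈ s, ∀ (p : Fin d → ℝ) (n : Fin d → ℤ), G i (fun j => p j + 2 * π * (n j : ℝ)) = G i p)
    {ε : ℝ} (hε : 0 < ε) :
    ∃ L₀ : ℕ, ∀ (L : ℕ) [NeZero L], Even L → L₀ ≤ L → ∀ i ∈ s,
      ‖((L ^ d : ℕ) : ℝ)⁻¹ • ∑ k ∈ (univ : Finset (TorusSite d L)).erase 0, G i (latticeMomentum L k) -
          ((2 * π) ^ d)⁻¹ • ∫ p in brillouin d, G i p‖ ≤ ε := by
  classical
  have hex : ∀ i ∈ s, ∃ L₀ : ℕ, ∀ (L : ℕ) [NeZero L], Even L → L₀ ≤ L →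
      ‖((L ^ d : ℕ) : ℝ)⁻¹ • ∑ k ∈ (univ : Finset (TorusSite d L)).erase 0, G i (latticeMomentum L k) -
          ((2 * π) ^ d)⁻¹ • ∫ p in brillouin d, G i p‖ ≤ ε :=
    fun i hi => momentumAverage_singular_approx hd (hC₀ i hi) (hC₁ i hi) (hG i hi) (hB i hi) (hper i hi) hε
  choose! L₀ hL₀ using hex
  exact ⟨s.sup L₀, fun L _ hev hL i hi => hL₀ i hi L hev ((Finset.le_sup hi).trans hL)⟩

variable (d) in
/-- **Finite families, bounded punctured class** (`d ≥ 1`): one `L₀` for finitely many symbols bounded on the zone,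
continuous off `0` and `2π`-periodic (`Finset.sup` of the thresholds of `momentumAverage_punctured_approx`). [folklore] -/
theorem momentumAverage_punctured_approx_finset (hd : 0 < d) {ι : Type*} (s : Finset ι)
    {G : ι → (Fin d → ℝ) → E} {B : ι → ℝ}
    (hG : ∀ i ∈ s, ContinuousOn (G i) (brillouin d \ {0})) (hB : ∀ i ∈ s, ∀ p ∈ brillouin d, ‖G i p‖ ≤ B i)
    (hper : ∀ i ∈ s, ∀ (p : Fin d → ℝ) (n : Fin d → ℤ), G i (fun j => p j + 2 * π * (n j : ℝ)) = G i p)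
    {ε : ℝ} (hε : 0 < ε) :
    ∃ L₀ : ℕ, ∀ (L : ℕ) [NeZero L], Even L → L₀ ≤ L → ∀ i ∈ s,
      ‖((L ^ d : ℕ) : ℝ)⁻¹ • ∑ k : TorusSite d L, G i (latticeMomentum L k) -
          ((2 * π) ^ d)⁻¹ • ∫ p in brillouin d, G i p‖ ≤ ε := by
  classical
  have hex : ∀ i ∈ s, ∃ L₀ : ℕ, ∀ (L : ℕ) [NeZero L], Even L → L₀ ≤ L →
      ‖((L ^ d : ℕ) : ℝ)⁻¹ • ∑ k : TorusSite d L, G i (latticeMomentum L k) -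
          ((2 * π) ^ d)⁻¹ • ∫ p in brillouin d, G i p‖ ≤ ε :=
    fun i hi => momentumAverage_punctured_approx hd (hG i hi) (hB i hi) (hper i hi) hε
  choose! L₀ hL₀ using hex
  exact ⟨s.sup L₀, fun L _ hev hL i hi => hL₀ i hi L hev ((Finset.le_sup hi).trans hL)⟩

variable (d) in
/-- **Finite families, sup-norm-majorant form** (`d ≥ 3`): one `L₀` for finitely many symbols `F i` with
`‖F i p‖ ≤ C i·‖p‖_∞⁻²` off `0`, continuous off `0`, `2π`-periodic. [folklore] -/
theorem momentumAverage_approx_of_norm_le_inv_norm_sq_finset (hd : 3 ≤ d) {ι : Type*} (s : Finset ι)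
    {F : ι → (Fin d → ℝ) → E} {C : ι → ℝ}
    (hcont : ∀ i ∈ s, ContinuousOn (F i) (brillouin d \ {0}))
    (hbd : ∀ i ∈ s, ∀ p ∈ brillouin d, p ≠ 0 → ‖F i p‖ ≤ C i * (‖p‖ ^ 2)⁻¹)
    (hper : ∀ i ∈ s, ∀ (p : Fin d → ℝ) (n : Fin d → ℤ), F i (fun j => p j + 2 * π * (n j : ℝ)) = F i p)
    {ε : ℝ} (hε : 0 < ε) :
    ∃ L₀ : ℕ, ∀ (L : ℕ) [NeZero L], Even L → L₀ ≤ L → ∀ i ∈ s,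
      ‖((L ^ d : ℕ) : ℝ)⁻¹ • ∑ k ∈ (univ : Finset (TorusSite d L)).erase 0, F i (latticeMomentum L k) -
          ((2 * π) ^ d)⁻¹ • ∫ p in brillouin d, F i p‖ ≤ ε := by
  classical
  have hex : ∀ i ∈ s, ∃ L₀ : ℕ, ∀ (L : ℕ) [NeZero L], Even L → L₀ ≤ L →
      ‖((L ^ d : ℕ) : ℝ)⁻¹ • ∑ k ∈ (univ : Finset (TorusSite d L)).erase 0, F i (latticeMomentum L k) -
          ((2 * π) ^ d)⁻¹ • ∫ p in brillouin d, F i p‖ ≤ ε :=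
    fun i hi => momentumAverage_approx_of_norm_le_inv_norm_sq d hd (hcont i hi) (hbd i hi) (hper i hi) hε
  choose! L₀ hL₀ using hex
  exact ⟨s.sup L₀, fun L _ hev hL i hi => hL₀ i hi L hev ((Finset.le_sup hi).trans hL)⟩

/-! ## §4 Consistency: ADS15 (3.15) re-derived from an5's generic singular theorem (second engine) -/

/-- The Green integrand `h_z = cos(p·z)/ε(p)` is continuous on the punctured zone (`ε ≠ 0` there). [folklore] -/
theorem continuousOn_greenIntegrand_puncturedZone (z : Site d) :
    ContinuousOn (greenIntegrand z) (brillouin d \ {0}) := by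
  have hnum : Continuous fun p : Fin d → ℝ => Real.cos (∑ i, p i * (z i : ℝ)) := by fun_prop
  refine hnum.continuousOn.div (continuous_dispersion d).continuousOn fun p hp => ?_
  exact (dispersion_pos_of_mem_brillouin hp.1 hp.2).ne'

/-- `h_z` is in an5's singular class with `C₀ = 0`, `C₁ = 1`: `|h_z(p)| ≤ 0 + 1/ε(p)` off the origin (`|cos| ≤ 1`).
[folklore] -/
theorem norm_greenIntegrand_le_inv_dispersion (z : Site d) {p : Fin d → ℝ} (hp : p ∈ brillouin d) (hp0 : p ≠ 0) :
    ‖greenIntegrand z p‖ ≤ 0 + 1 / dispersion p := by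
  have hε := dispersion_pos_of_mem_brillouin hp hp0
  rw [Real.norm_eq_abs, greenIntegrand, abs_div, abs_of_pos hε, zero_add]
  gcongr
  exact Real.abs_cos_le_one _

/-- **CONSISTENCY (second engine): ADS15 §3.3, arXiv v3 (3.15) — `lim_L G_L(x,y) = G(x,y)` for the nearest-neighbour
model, `d ≥ 3`, along even `L` — i.e. EXACTLY the statement of lit1's `LatticeGreenRiemannSum.torusGreen_tendsto_latticeGreen`
(2026-08-15, hard-wired proof), here obtained from an5-g8's generic `PuncturedRiemannSum.momentumAverage_singular_approx`
(2026-08-19) with `G = h_z`, `C₀ = 0`, `C₁ = 1`.**  An `example`, not a `theorem`: the statement is already a landed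
declaration and the gate rejects restatements; the check is the elaboration of this block at every build.
[cite: AizenmanDuminilCopinSidoraviciusCMP2015, §3.3, arXiv v3 eq. (3.15)] -/
example (hd : 3 ≤ d) (z : Site d) {ε : ℝ} (hε : 0 < ε) :
    ∃ L₀ : ℕ, ∀ (L : ℕ) [NeZero L], Even L → L₀ ≤ L →
      |torusGreen (Torus.proj L z) - latticeGreen z| ≤ ε := by
  obtain ⟨L₀, hL₀⟩ := momentumAverage_singular_approx hd (E := ℝ) le_rfl zero_le_one
    (continuousOn_greenIntegrand_puncturedZone z) (fun p hp hp0 => norm_greenIntegrand_le_inv_dispersion z hp hp0)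
    (greenIntegrand_add_int_mul z) hε
  refine ⟨L₀, fun L _ hev hL => ?_⟩
  have h := hL₀ L hev hL
  rw [torusGreen_proj_eq, latticeGreen_eq]
  rw [smul_eq_mul, smul_eq_mul, Real.norm_eq_abs] at h
  have hL0 : ((L ^ d : ℕ) : ℝ) = (L : ℝ) ^ d := by push_cast; ring
  rw [hL0] at h
  rwa [div_eq_inv_mul, div_eq_inv_mul]

/-- The same check THROUGH THE BRIDGE of §2 (sup-norm majorant `|h_z(p)| ≤ (π²/2)‖p‖⁻²`,
`LatticeGreenRiemannSum.abs_greenIntegrand_le`): the sup-norm road lands on the identical statement. [folklore] -/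
example (hd : 3 ≤ d) (z : Site d) {ε : ℝ} (hε : 0 < ε) :
    ∃ L₀ : ℕ, ∀ (L : ℕ) [NeZero L], Even L → L₀ ≤ L →
      |torusGreen (Torus.proj L z) - latticeGreen z| ≤ ε := by
  obtain ⟨L₀, hL₀⟩ := momentumAverage_approx_of_norm_le_inv_norm_sq d hd (E := ℝ)
    (continuousOn_greenIntegrand_puncturedZone z)
    (fun p hp hp0 => by rw [Real.norm_eq_abs]; exact abs_greenIntegrand_le hp hp0)
    (greenIntegrand_add_int_mul z) hε
  refine ⟨L₀, fun L _ hev hL => ?_⟩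
  have h := hL₀ L hev hL
  rw [torusGreen_proj_eq, latticeGreen_eq]
  rw [smul_eq_mul, smul_eq_mul, Real.norm_eq_abs] at h
  have hL0 : ((L ^ d : ℕ) : ℝ) = (L : ℝ) ^ d := by push_cast; ring
  rw [hL0] at h
  rwa [div_eq_inv_mul, div_eq_inv_mul]

end Literature.MathematicalPhysics.QuantumFieldTheory.Balaban1983to89.Beta.PuncturedRiemannSumFamily

end
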